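import Summits.AtomisticToContinuum.FouriersLaw.Theorems.HiddenChargeMazurOddChargeAlgebraSymbol
import Summits.AtomisticToContinuum.FouriersLaw.Theorems.HiddenChargeMazurOddChargeAlgebraToolkitB

/-!
# Odd conservation laws of the pinned anharmonic chain — the single-site case

The span-`0` case of the classification behind the negative edge of
`HiddenChargeMazur.OddChargeExists`: a momentum-odd polynomial `f ∈ ℝ[q_0, p_0]` with
`N (L₊ f) = 0` vanishes (`lam ≠ 0`).

* `coeff_rev`, `odd_weight_of_rev_eq_neg`: momentum reversal `Θ` multiplies the coefficient of the
  monomial `m` by `(-1)^(momentum degree of m)`, so every monomial of a `Θ`-odd polynomial has odd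
  momentum degree.
* The one-site reduction `π : q_x ↦ q_0, p_x ↦ p_0` (an algebra endomorphism) kills the
  shift-coboundaries `χ - S χ` and fixes `ℝ[q_0, p_0]`.  `N (L₊ f) = 0` makes `S (L₊ f)` a
  coboundary (`exists_sub_nf`), and applying `π` to `L₊ f = p_0 ∂_{q_0} f + F⁺_0 ∂_{p_0} f` yields
  the ONE-SITE IDENTITY `p_0 ∂_{q_0} f = lam q_0³ ∂_{p_0} f` (i.e. `{p²/2 + lam q⁴/4, f} = 0`).
* No nonzero polynomial all of whose monomials contain `p_0` satisfies the one-site identity: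
  compare the coefficients of `q^{a+3} p^{b-1}` for a monomial `q^a p^b` of `f` of minimal
  `p_0`-degree `b ≥ 1`. [folklore]
-/

noncomputable section

open MvPolynomial Finsupp
open scoped BigOperators

namespace Summit.AtomisticToContinuum.FouriersLaw.Theorems.OddChargeAlgebra

/-! ## Momentum reversal on coefficients -/

/-- The coefficients of `Θ f`: `coeff m (Θ f) = (-1)^(momentum degree of m) · coeff m f`.
[folklore] -/
theorem coeff_rev (f : R) (m : Var →₀ ℕ) :
    (rev f).coeff m = (-1) ^ weight pwt m * f.coeff m := by
  induction f using MvPolynomial.induction_on' with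
  | monomial n c =>
    rw [rev_monomial, coeff_C_mul, coeff_monomial]
    split_ifs with h
    · rw [h]
    · rw [mul_zero, mul_zero]
  | add p q hp hq => rw [map_add, coeff_add, coeff_add, hp, hq, mul_add]

/-- Every monomial of a momentum-odd polynomial (`Θ f = -f`) has odd momentum degree. [folklore] -/
theorem odd_weight_of_rev_eq_neg :
    ∀ f : R, rev f = -f → ∀ m ∈ f.support, Odd (Finsupp.weight pwt m) := by
  intro f hf m hm
  rcases Nat.even_or_odd (weight pwt m) with he | ho
  · have h := congrArg (coeff m) hf
    rw [coeff_rev, coeff_neg, he.neg_one_pow, one_mul] at h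
    exact absurd (self_eq_neg.mp h) (MvPolynomial.mem_support_iff.mp hm)
  · exact ho

/-- A monomial of odd momentum degree of a polynomial on the single site `0` contains `p_0`.
[folklore] -/
theorem inr_zero_ne_zero_of_odd_weight {f : R} (hf : f ∈ supported ℝ (Var.site ⁻¹' {(0 : ℤ)}))
    {m : Var →₀ ℕ} (hm : m ∈ f.support) (hodd : Odd (weight pwt m)) : m (Sum.inr 0) ≠ 0 := by
  intro h0
  have hw : weight pwt m = 0 := by
    rw [weight_apply, Finsupp.sum]
    refine Finset.sum_eq_zero fun i hi => ?_
    have hs := site_mem_of_mem_supported hf hm hi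
    rcases i with y | y
    · simp [pwt]
    · obtain rfl : y = 0 := by simpa [Var.site] using hs
      exact absurd h0 (Finsupp.mem_support_iff.mp hi)
  rw [hw] at hodd
  exact Nat.not_odd_zero hodd

/-! ## The one-site reduction `π : q_x ↦ q_0, p_x ↦ p_0` -/

/-- `π ∘ S = π`. [folklore] -/
theorem onesite_shift (h : R) :
    aeval (Sum.elim (fun _ => X (Sum.inl 0)) (fun _ => X (Sum.inr 0)) : Var → R) (shift h) =
      aeval (Sum.elim (fun _ => X (Sum.inl 0)) (fun _ => X (Sum.inr 0)) : Var → R) h := by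
  have key : (aeval (Sum.elim (fun _ => X (Sum.inl 0)) (fun _ => X (Sum.inr 0)) : Var → R)).comp
      shift = aeval (Sum.elim (fun _ => X (Sum.inl 0)) (fun _ => X (Sum.inr 0)) : Var → R) := by
    refine MvPolynomial.algHom_ext fun w => ?_
    rcases w with y | y <;> simp
  exact DFunLike.congr_fun key h

/-- `π` fixes `ℝ[q_0, p_0]`. [folklore] -/
theorem onesite_eq_self {h : R} (hh : h ∈ supported ℝ (Var.site ⁻¹' {(0 : ℤ)})) :
    aeval (Sum.elim (fun _ => X (Sum.inl 0)) (fun _ => X (Sum.inr 0)) : Var → R) h = h := by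
  change (aeval (Sum.elim (fun _ => X (Sum.inl 0)) (fun _ => X (Sum.inr 0)) : Var → R)).toRingHom h
    = RingHom.id R h
  refine hom_congr_vars ?_ (fun i hi _ => ?_) rfl
  · ext r
    simp [MvPolynomial.algebraMap_eq]
  · have hs : Var.site i = 0 := by
      have := MvPolynomial.mem_supported.mp hh hi
      simpa using this
    rcases i with y | y
    · obtain rfl : y = 0 := hs
      simp
    · obtain rfl : y = 0 := hs
      simp

/-- `π (F⁺_0) = -lam q_0³`: the interaction cubes collapse under `q_{±1} ↦ q_0`. [folklore] -/
theorem onesite_forcePlus_zero (lam β : ℝ) :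
    aeval (Sum.elim (fun _ => X (Sum.inl 0)) (fun _ => X (Sum.inr 0)) : Var → R) (forcePlus lam β 0)
      = -(C lam * X (Sum.inl 0) ^ 3) := by
  simp only [forcePlus, map_add, map_neg, map_sub, map_mul, map_pow, aeval_X, aeval_C,
    MvPolynomial.algebraMap_eq, Sum.elim_inl, sub_self]
  ring

/-- On `ℝ[q_0, p_0]`: `L₊ f = p_0 ∂_{q_0} f + F⁺_0 ∂_{p_0} f`. [folklore] -/
theorem lplus_eq_of_site_zero (lam β : ℝ) {f : R} (hf : f ∈ supported ℝ (Var.site ⁻¹' {(0 : ℤ)})) :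
    lplus lam β f =
      X (Sum.inr 0) * pderiv (Sum.inl 0) f + forcePlus lam β 0 * pderiv (Sum.inr 0) f := by
  have hf' : f ∈ supported ℝ (Var.site ⁻¹' ((({0} : Finset ℤ)) : Set ℤ)) := by
    rwa [Finset.coe_singleton]
  rw [lplus_eq_Aplus_add_sum lam β {0} hf', Aplus_eq_finset_sum hf', Finset.sum_singleton,
    Finset.sum_singleton]

/-- THE ONE-SITE IDENTITY.  If `f ∈ ℝ[q_0, p_0]` satisfies the conservation law `N (L₊ f) = 0`,
then `p_0 ∂_{q_0} f = lam q_0³ ∂_{p_0} f`, i.e. `f` Poisson-commutes with the one-site Hamiltonian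
`p²/2 + lam q⁴/4` (apply `π` to the coboundary `S (L₊ f) = χ - S χ`). [folklore] -/
theorem one_site_identity (lam β : ℝ) {f : R} (hf : f ∈ supported ℝ (Var.site ⁻¹' {(0 : ℤ)}))
    (hN : nf (lplus lam β f) = 0) :
    X (Sum.inr 0) * pderiv (Sum.inl 0) f = C lam * X (Sum.inl 0) ^ 3 * pderiv (Sum.inr 0) f := by
  -- Step 1: `S (L₊ f)` is a genuine coboundary.
  have hf' : f ∈ supported ℝ (Var.site ⁻¹' Set.Icc (0 : ℤ) 0) := by
    rwa [Set.Icc_self]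
  have h2 := shift_mem_supported_site (lplus_mem_supported_site lam β hf')
  have h3 : shift (lplus lam β f) ∈ supported ℝ (Var.site ⁻¹' Set.Icc (0 : ℤ) ((2 : ℕ) : ℤ)) := by
    refine supported_mono (fun v hv => ?_) h2
    simp only [Set.mem_preimage, Set.mem_Icc] at hv ⊢
    omega
  obtain ⟨χ, -, hχ⟩ := exists_sub_nf 2 _ h3
  rw [nf_shift, hN, sub_zero] at hχ
  -- Step 2: apply the one-site reduction `π`.
  have hπ :=
    congrArg (aeval (Sum.elim (fun _ => X (Sum.inl 0)) (fun _ => X (Sum.inr 0)) : Var → R)) hχ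
  rw [map_sub, onesite_shift, onesite_shift, sub_self, lplus_eq_of_site_zero lam β hf, map_add,
    map_mul, map_mul, aeval_X, Sum.elim_inr, onesite_eq_self (pderiv_mem_supported hf _),
    onesite_forcePlus_zero, onesite_eq_self (pderiv_mem_supported hf _), neg_mul,
    add_neg_eq_zero] at hπ
  rw [hπ, mul_assoc]

/-! ## No odd solution of the one-site identity -/

/-- A polynomial all of whose monomials contain `p_0` and which satisfies the one-site identity
`p_0 ∂_{q_0} f = lam q_0³ ∂_{p_0} f` (`lam ≠ 0`) vanishes: for a monomial `q_0^a p_0^b ⋯` of `f` of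
minimal `p_0`-degree `b ≥ 1`, the coefficient of `q_0^{a+3} p_0^{b-1} ⋯` is `lam · b · coeff ≠ 0` on
the right and `0` on the left. [folklore] -/
theorem eq_zero_of_one_site_identity {lam : ℝ} (hl : lam ≠ 0) {f : R}
    (hp : ∀ m ∈ f.support, m (Sum.inr 0) ≠ 0)
    (hid : X (Sum.inr 0) * pderiv (Sum.inl 0) f =
      C lam * X (Sum.inl 0) ^ 3 * pderiv (Sum.inr 0) f) : f = 0 := by
  classical
  by_contra hf0
  obtain ⟨m₀, hm₀, hmin⟩ :=
    Finset.exists_min_image f.support (fun m => m (Sum.inr 0)) (support_nonempty.mpr hf0)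
  have hb : 1 ≤ m₀ (Sum.inr 0) := Nat.one_le_iff_ne_zero.mpr (hp m₀ hm₀)
  have hle : Finsupp.single (Sum.inr (0 : ℤ) : Var) 1 ≤ m₀ := Finsupp.single_le_iff.mpr hb
  have key := congrArg (coeff (m₀ - Finsupp.single (Sum.inr (0 : ℤ) : Var) 1
    + Finsupp.single (Sum.inl (0 : ℤ) : Var) 3)) hid
  -- the right-hand side coefficient is `lam * (coeff m₀ f * b) ≠ 0`
  have hR : coeff (m₀ - Finsupp.single (Sum.inr (0 : ℤ) : Var) 1
        + Finsupp.single (Sum.inl (0 : ℤ) : Var) 3)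
        (C lam * X (Sum.inl 0) ^ 3 * pderiv (Sum.inr 0) f)
      = lam * (coeff m₀ f *
          ((((m₀ - Finsupp.single (Sum.inr (0 : ℤ) : Var) 1 : Var →₀ ℕ) (Sum.inr 0) : ℕ) : ℝ)
            + 1)) := by
    rw [C_mul_X_pow_eq_monomial, coeff_monomial_mul', if_pos le_add_self, add_tsub_cancel_right,
      coeff_pderiv, tsub_add_cancel_of_le hle]
  -- the left-hand side coefficient vanishes by minimality of `b`
  have hL : coeff (m₀ - Finsupp.single (Sum.inr (0 : ℤ) : Var) 1
        + Finsupp.single (Sum.inl (0 : ℤ) : Var) 3) (X (Sum.inr 0) * pderiv (Sum.inl 0) f) = 0 := by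
    rw [coeff_X_mul']
    split_ifs with hv
    · rw [coeff_pderiv]
      have hc : coeff (m₀ - Finsupp.single (Sum.inr (0 : ℤ) : Var) 1
          + Finsupp.single (Sum.inl (0 : ℤ) : Var) 3 - Finsupp.single (Sum.inr (0 : ℤ) : Var) 1
          + Finsupp.single (Sum.inl (0 : ℤ) : Var) 1) f = 0 := by
        by_contra hc
        have h1 := hmin _ (MvPolynomial.mem_support_iff.mpr hc)
        simp only [Finsupp.coe_add, Finsupp.coe_tsub, Pi.add_apply, Pi.sub_apply,
          Finsupp.single_apply, if_true, reduceCtorEq, if_false] at h1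
        omega
      rw [hc, zero_mul]
    · rfl
  rw [hL, hR] at key
  exact mul_ne_zero hl (mul_ne_zero (MvPolynomial.mem_support_iff.mp hm₀)
    (Nat.cast_add_one_ne_zero _)) key.symm

/-! ## The headline -/

/-- The span-`0` case of the classification: a momentum-odd `wt`-homogeneous polynomial
`f ∈ ℝ[q_0, p_0]` with `N (L₊ f) = 0` vanishes (`lam ≠ 0`; `β` and the weight play no role).
By the one-site identity `f` Poisson-commutes with `p²/2 + lam q⁴/4`, and no nonzero polynomial
all of whose monomials have odd momentum degree does. [folklore] -/
theorem cplus_span_zero : ∀ (lam β : ℝ) (f : R) (W : ℕ), lam ≠ 0 → β ≠ 0 →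
    f ∈ supported ℝ (Var.site ⁻¹' {(0 : ℤ)}) → rev f = -f → IsWeightedHomogeneous wt f W →
    nf (lplus lam β f) = 0 → f = 0 := by
  intro lam β f _W hl _hβ hf hodd _hW hN
  exact eq_zero_of_one_site_identity hl
    (fun m hm => inr_zero_ne_zero_of_odd_weight hf hm (odd_weight_of_rev_eq_neg f hodd m hm))
    (one_site_identity lam β hf hN)

end Summit.AtomisticToContinuum.FouriersLaw.Theorems.OddChargeAlgebra

end
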